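import Summits.Parity.GeneralizedHardyLittlewood.Theses.LiouvilleShiftedTables
import Summits.Parity.GeneralizedHardyLittlewood.Theses.LiouvilleMAD
import Summits.Parity.GeneralizedHardyLittlewood.Theorems.LiouvilleShiftedTablesElliottHalberstamLiftingLever
import Summits.Parity.GeneralizedHardyLittlewood.Theorems.LiouvilleShiftedTablesElliottHalberstamLiftingMultiples
import Summits.Parity.GeneralizedHardyLittlewood.Theorems.LiouvilleShiftedTablesElliottHalberstamLiftingFactorable

/-!
# Line `LiftProof` — skeleton v4 (thin), lead prover-line-stmt-Parity-14092-1 (continuation of lead -0)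

Crux decl: `Summit.Parity.GeneralizedHardyLittlewood.Theses.LiouvilleShiftedTables.ElliottHalberstam`
(`= Literature.NumberTheory.Sieve.LevelOfDistribution.ElliottHalberstam := ∀ θ < 1, PrimesHaveLevel θ`,
the Elliott–Halberstam conjecture; both route decls are the Literature constant by `rfl`).

v4 = v3 with every PROVED component replaced by its LANDED tree version (all three ACCEPTED):
* lever `primeAPError_le_lift`, `totient_ratio_le` — `Theorems/…LiftingLever.lean` (p85967);
* W-trick form `elliottHalberstam_iff_multiples_const` — `Theorems/…LiftingMultiples.lean` (p86337);
* factorable normal form `elliottHalberstam_iff_ehFactorable : EH ↔ EHFactorable` — `Theorems/…LiftingFactorable.lean` (p86346).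

STUBS: exactly one — `stub_ehFactorable : EHFactorable` (the landed
`Summit.Parity.GeneralizedHardyLittlewood.Theorems.ElliottHalberstam.Lifting.EHFactorable`).
HONEST STATUS: kernel-EQUIVALENT to the crux (both directions landed), i.e. the stub IS the named open
conjecture `Literature.NumberTheory.Sieve.LevelOfDistribution.ElliottHalberstam` (declared bridge premise of the two
CONDITIONAL routes; item informal `[difficulty: open-problem]`). `ElliottHalberstam_of` concludes the crux BY NAME.
-/

namespace Summit.Parity.GeneralizedHardyLittlewood.Cruxes.ElliottHalberstam.Lines.LiftProof

open Summit.Parity.GeneralizedHardyLittlewood.Theorems.ElliottHalberstam.Lifting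

/-- **STUB** (the single open statement of line `LiftProof`): the Elliott–Halberstam bound restricted to
moduli `q ≤ x^{θ−ε}` carrying a divisor in `(x^κ, 2x^κ]`, for every `θ < 1` and `κ ∈ (0,1)`.
Kernel-equivalent to the crux (`elliottHalberstam_iff_ehFactorable`, landed p86346). -/
theorem stub_ehFactorable : EHFactorable := by
  sorry

/-- **Composition**: the crux `ElliottHalberstam` of route `LiouvilleShiftedTables`, BY NAME, from the stub
(level lifting `EHFactorable → EH`, the `.mpr` direction of the landed equivalence). -/
theorem ElliottHalberstam_of :
    Summit.Parity.GeneralizedHardyLittlewood.Theses.LiouvilleShiftedTables.ElliottHalberstam :=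
  elliottHalberstam_iff_ehFactorable.mpr stub_ehFactorable

/-- The crux in the gate's `<Crux>_proof` naming (route `LiouvilleShiftedTables`). -/
theorem ElliottHalberstam_proof :
    Summit.Parity.GeneralizedHardyLittlewood.Theses.LiouvilleShiftedTables.ElliottHalberstam :=
  ElliottHalberstam_of

/-- The same crux as wanted by route `LiouvilleMAD` (its decl is the same Literature constant, `rfl`). -/
theorem ElliottHalberstam_proof_MAD :
    Summit.Parity.GeneralizedHardyLittlewood.Theses.LiouvilleMAD.ElliottHalberstam :=
  ElliottHalberstam_of

/-- Conversely the stub is implied by the crux (so it is EXACTLY as hard): recorded for the census. -/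
theorem stub_ehFactorable_of_crux
    (h : Summit.Parity.GeneralizedHardyLittlewood.Theses.LiouvilleShiftedTables.ElliottHalberstam) :
    EHFactorable :=
  elliottHalberstam_iff_ehFactorable.mp h

end Summit.Parity.GeneralizedHardyLittlewood.Cruxes.ElliottHalberstam.Lines.LiftProof
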